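import Summits.AtomisticToContinuum.Crystallization.Theorems.HullMinimalityLayeredWindowsFrequently
import Summits.AtomisticToContinuum.Crystallization.Theorems.HullMinimalityLayeredWindowsNecessity

/-!
# Crux `HullMinimality.LayeredWindows` (stmt-AtomisticToContinuum-11778): named glue for the minimal core
# {S1 = two-shell-good windows frequently, S2' = clean core of large good balls of a ground state} (lead c5)

The live line `registered` closes the crux modulo {S1, S2 = item 16827 `NashNearField`}; the strategist's alternative
line `minimal_core` (Cruxes/LayeredWindows/Lines/minimal_core.lean) replaces S2 by the WEAKER, ground-state-only,
qualitative statement S2' — the conclusion of the landed `cleanCentre_of_goodBall` with its hypothesis `NashNearField`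
removed.  This file lands the by-name glue that a split of the crux into the pieces (S1, S2') needs
(`Cruxes/LayeredWindows/SPLIT.md`, "alternative second piece"):

* `cleanCentresFreq_of_goodWindowsFreq_of_cleanCore` — S1 + S2' give clean centres frequently (pure logic);
* `layeredWindows_of_core : S1 → S2' → HullMinimality.LayeredWindows` — THE GLUE (through the landed
  `windowsOfGluing_freq` with `PrestressSplitKorn.stub_layeredGluing`);
* S2' is discharged by item 16827 through the landed `cleanCentre_of_goodBall : NashNearField → S2'`, so the live
  line's residual {S1, 16827} still closes the crux through this glue
  (`layeredWindows_of_goodWindowsFreq_of_nashNearField'`);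
* `layeredWindows_iff_goodWindowsFreq_of_cleanCore : S2' → (LayeredWindows ↔ S1)` — modulo S2' the crux is EQUIVALENT to
  its positional core S1 (necessity is the landed `layeredWindows_necessity`).

Both pieces are stated INLINE (no new definitions): S1 exactly as the registered stub `stub_twoShellGoodWindowsFreq`,
S2' exactly as the registered stub `stub_cleanCoreOfGoodBall`.
-/

noncomputable section

open scoped BigOperators Classical InnerProductSpace
open Filter Topology

namespace Summit.AtomisticToContinuum.Crystallization.Theorems.LayeredWindowsLocal

open Summit.AtomisticToContinuum.Crystallization.Theses
open Summit.AtomisticToContinuum.Crystallization.Theorems.PrestressSplitKorn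
open Summit.AtomisticToContinuum.Crystallization.Theorems.DefectFreeCrystallizes.Negative.PredicateAPI (Good)
open Literature.MathematicalPhysics.StatisticalMechanics Literature.Geometry.DiscreteGeometry
open Summit.AtomisticToContinuum.Crystallization.Theorems.ChargedEnergyGapNegative (E3)

/-- **Clean centres frequently from S1 and S2'** (pure logic): all-two-shell-good `ρ`-balls frequently in `N` (S1) and
the clean core of large good balls of a ground state (S2') give, for every `(η, R')`, frequently in `N`, a particle whose
`R'`-ball is all `Good` and all `LayeredNear η`. -/
theorem cleanCentresFreq_of_goodWindowsFreq_of_cleanCore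
    (h1 : ∀ x : (N : ℕ) → (Fin N → E3), (∀ N, IsGroundState lennardJones (x N)) → ∀ ρ : ℝ,
      ∃ᶠ N : ℕ in atTop, ∃ i : Fin N, ∀ j : Fin N, dist (x N j) (x N i) ≤ ρ → IsTwoShellGood (1 / 20) (47 / 50) 1 (x N) j)
    (h2 : ∀ η : ℝ, 0 < η → ∀ R' : ℝ, ∃ ρ : ℝ, ∀ (N : ℕ) (y : Fin N → E3), IsGroundState lennardJones y →
      ∀ i₀ : Fin N, (∀ j : Fin N, dist (y j) (y i₀) ≤ ρ → IsTwoShellGood (1 / 20) (47 / 50) 1 y j) →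
        ∃ i : Fin N, ∀ j : Fin N, dist (y j) (y i) ≤ R' → Good y j ∧ LayeredNear η y j)
    (x : (N : ℕ) → (Fin N → E3)) (hx : ∀ N, IsGroundState lennardJones (x N)) :
    ∀ η : ℝ, 0 < η → ∀ R' : ℝ, ∃ᶠ N : ℕ in atTop, ∃ i : Fin N, ∀ j : Fin N,
      dist (x N j) (x N i) ≤ R' → Good (x N) j ∧ LayeredNear η (x N) j := by
  intro η hη R'
  obtain ⟨ρ, hρ⟩ := h2 η hη R'
  exact (h1 x hx ρ).mono fun N ⟨i₀, hi₀⟩ => hρ N (x N) (hx N) i₀ hi₀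

/-- **THE GLUE `LayeredWindows ⇐ S1 ∧ S2'`**: two-shell-good windows frequently (S1, the positional core, necessary by
`layeredWindows_necessity`) and the clean core of large good balls of a ground state (S2', qualitative, minimisers only,
⇐ item 16827 by the landed `cleanCentre_of_goodBall`) imply `HullMinimality.LayeredWindows` (stmt-AtomisticToContinuum-11778) —
clean centres frequently, then one in-layer spacing and windows at every scale by the landed `windowsOfGluing_freq` with
the gluing lemma `PrestressSplitKorn.stub_layeredGluing`. -/
theorem layeredWindows_of_core
    (h1 : ∀ x : (N : ℕ) → (Fin N → E3), (∀ N, IsGroundState lennardJones (x N)) → ∀ ρ : ℝ,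
      ∃ᶠ N : ℕ in atTop, ∃ i : Fin N, ∀ j : Fin N, dist (x N j) (x N i) ≤ ρ → IsTwoShellGood (1 / 20) (47 / 50) 1 (x N) j)
    (h2 : ∀ η : ℝ, 0 < η → ∀ R' : ℝ, ∃ ρ : ℝ, ∀ (N : ℕ) (y : Fin N → E3), IsGroundState lennardJones y →
      ∀ i₀ : Fin N, (∀ j : Fin N, dist (y j) (y i₀) ≤ ρ → IsTwoShellGood (1 / 20) (47 / 50) 1 y j) →
        ∃ i : Fin N, ∀ j : Fin N, dist (y j) (y i) ≤ R' → Good y j ∧ LayeredNear η y j) :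
    Summit.AtomisticToContinuum.Crystallization.Theses.HullMinimality.LayeredWindows :=
  fun x hx => windowsOfGluing_freq stub_layeredGluing x hx
    (cleanCentresFreq_of_goodWindowsFreq_of_cleanCore h1 h2 x hx)

/-- The live line's residual {S1, item 16827} closes the crux THROUGH the minimal-core glue: S2' is discharged by
item 16827 via the landed `cleanCentre_of_goodBall : NashNearField → S2'` (second proof of
`layeredWindows_of_goodWindows_freq`, factoring through S2'). -/
theorem layeredWindows_of_goodWindowsFreq_of_nashNearField'
    (h1 : ∀ x : (N : ℕ) → (Fin N → E3), (∀ N, IsGroundState lennardJones (x N)) → ∀ ρ : ℝ,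
      ∃ᶠ N : ℕ in atTop, ∃ i : Fin N, ∀ j : Fin N, dist (x N j) (x N i) ≤ ρ → IsTwoShellGood (1 / 20) (47 / 50) 1 (x N) j)
    (hNF : Summit.AtomisticToContinuum.Crystallization.Theses.NashClassCertificates.NashNearField) :
    Summit.AtomisticToContinuum.Crystallization.Theses.HullMinimality.LayeredWindows :=
  layeredWindows_of_core h1 (cleanCentre_of_goodBall hNF)

/-- **Modulo S2' the crux is EQUIVALENT to its positional core S1** (necessity: the landed `layeredWindows_necessity`;
sufficiency: `layeredWindows_of_core`). -/
theorem layeredWindows_iff_goodWindowsFreq_of_cleanCore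
    (h2 : ∀ η : ℝ, 0 < η → ∀ R' : ℝ, ∃ ρ : ℝ, ∀ (N : ℕ) (y : Fin N → E3), IsGroundState lennardJones y →
      ∀ i₀ : Fin N, (∀ j : Fin N, dist (y j) (y i₀) ≤ ρ → IsTwoShellGood (1 / 20) (47 / 50) 1 y j) →
        ∃ i : Fin N, ∀ j : Fin N, dist (y j) (y i) ≤ R' → Good y j ∧ LayeredNear η y j) :
    Summit.AtomisticToContinuum.Crystallization.Theses.HullMinimality.LayeredWindows ↔
      ∀ x : (N : ℕ) → (Fin N → E3), (∀ N, IsGroundState lennardJones (x N)) → ∀ ρ : ℝ,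
        ∃ᶠ N : ℕ in atTop, ∃ i : Fin N, ∀ j : Fin N, dist (x N j) (x N i) ≤ ρ → IsTwoShellGood (1 / 20) (47 / 50) 1 (x N) j :=
  ⟨layeredWindows_necessity, fun h1 => layeredWindows_of_core h1 h2⟩

/-- **Landing anchor of this file** (registered sub-goal of crux stmt-AtomisticToContinuum-11778, fully qualified, one line):
`LayeredWindows ⇐ S1 ∧ S2'` — re-exports `layeredWindows_of_core`. -/
theorem layeredWindowsCore_anchor : (∀ x : (N : ℕ) → (Fin N → EuclideanSpace ℝ (Fin 3)), (∀ N, Literature.MathematicalPhysics.StatisticalMechanics.IsGroundState Literature.MathematicalPhysics.StatisticalMechanics.lennardJones (x N)) → ∀ ρ : ℝ, ∃ᶠ N : ℕ in Filter.atTop, ∃ i : Fin N, ∀ j : Fin N, dist (x N j) (x N i) ≤ ρ → Literature.Geometry.DiscreteGeometry.IsTwoShellGood (1 / 20) (47 / 50) 1 (x N) j) → (∀ η : ℝ, 0 < η → ∀ R' : ℝ, ∃ ρ : ℝ, ∀ (N : ℕ) (y : Fin N → EuclideanSpace ℝ (Fin 3)), Literature.MathematicalPhysics.StatisticalMechanics.IsGroundState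 Literature.MathematicalPhysics.StatisticalMechanics.lennardJones y → ∀ i₀ : Fin N, (∀ j : Fin N, dist (y j) (y i₀) ≤ ρ → Literature.Geometry.DiscreteGeometry.IsTwoShellGood (1 / 20) (47 / 50) 1 y j) → ∃ i : Fin N, ∀ j : Fin N, dist (y j) (y i) ≤ R' → Summit.AtomisticToContinuum.Crystallization.Theorems.DefectFreeCrystallizes.Negative.PredicateAPI.Good y j ∧ Summit.AtomisticToContinuum.Crystallization.Theorems.PrestressSplitKorn.LayeredNear η y j) → Summit.AtomisticToContinuum.Crystallization.Theses.HullMinimality.LayeredWindows :=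
  fun h1 h2 => layeredWindows_of_core h1 h2

end Summit.AtomisticToContinuum.Crystallization.Theorems.LayeredWindowsLocal

end
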